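import Literature.NumberTheory.GaloisRepresentations.PicardFrobeniusDegDet
import Literature.NumberTheory.EllipticCurves.TateModuleCharpolyOfDegreeShift
import HarnessLib

/-!
# Galois representations of Picard curves from a degree function with ÉTALE kernel counts only

Topic `Literature/NumberTheory/GaloisRepresentations`; **proof file** (theorems only; no definitions, no named
facts).  Toward `picardCurve_exists_lambdaAdicRep` (Upton 2009).

`picardCurve_exists_lambdaAdicRep_of_degreeFunction` (`PicardFrobeniusDegreeFunction`) reduced Upton's theorem
to the existence of the degree function `δ(F) = deg F(φ)` on `ℤ[φ] ⊆ End J(C_f)` over finite fields, asking in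
clause (i) for the kernel count `#ker F(φ)[ℓ^∞] = ℓ^{v_ℓ(δ F)}` for EVERY monic `F` with `δ F ≠ 0` — which for
an inseparable `F(φ)` (`char k ∣ F(0)`) is the statement "`deg =` separable degree `×` a power of `char k`",
i.e. the `p`-power order of connected finite group schemes.  By the shift lemma
`TateModule.forall_ker_of_shift` (`TateModuleCharpolyOfDegreeShift`: `δ` is `ℓ`-adically continuous, and the
`ℓ`-primary kernels of `F(φ)` and `(F + c ℓ^M)(φ)` coincide for `M ≫ 0`) that input is superfluous:

* `picardCurve_exists_lambdaAdicRep_of_degreeFunction_etale` — the same door with clause (i) required only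
  for monic `F` with `F(0) ≠ 0` in `k`, i.e. for `F(φ)` ÉTALE (`d F(φ)_0 = F(0)`; Milne 1986, §19, proof of
  Thm. 19.1), where `deg F(φ) = #ker F(φ)` is the elementary count of geometric points of a finite étale
  group scheme (in the tree for abelian varieties: `AbelianVariety.natCard_kerPoints_aeval_frobeniusHom`,
  `Motives/AbelianVarietyFrobeniusKernel`).

So the geometric input of Upton's theorem is now exactly: `#Pic[ℓ^n] = ℓ^{2gn}`; a multiplicative `δ` on `ℤ[X]`,
polynomial on monic polynomials of each degree, with monic `P`, `P(n) = δ(X - n)` (Mumford §19 Thm. 2 for the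
Jacobian of `y^p = f(x)`); `#ker F(φ) = |δ F|_ℓ⁻¹` on `ℓ`-primary torsion for ÉTALE `F(φ)`; and
`δ(X^r - 1) = #Pic⁰(C_Ω)^{φ^r}`.

## References

* [MumfordAV1970] D. Mumford, *Abelian Varieties* (1970), §19 Thm. 2, Thm. 4; §21.
* [Milne1986AbelianVarieties] J. S. Milne, *Abelian varieties* (Cornell–Silverman 1986), §12 Prop. 12.9;
  §19, proof of Thm. 19.1 (p. 145).
* [Upton2009] M. Upton, J. Algebra 322 (2009), Thm. 2.1 and §4.
-/

noncomputable section

open Polynomial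
open scoped Classical AddSubgroup

namespace Literature.NumberTheory.GaloisRepresentations

open Literature.NumberTheory.EllipticCurves Literature.NumberTheory.DiophantineGeometry
  Literature.NumberTheory.DiophantineGeometry.AlgFunctionField SuperellipticFunctionField

/-- Over a finite field `k` in which the prime `ℓ` is invertible, every monic `F ∈ ℤ[X]` can be shifted by
`c ℓ^M` to a polynomial with constant term non-zero in `k` (`TateModule.shift_coeff_zero_not_dvd` for the
characteristic of `k`). [folklore] -/
theorem exists_shift_coeff_zero_cast_ne_zero (k : Type*) [Field k] [Fintype k] {ℓ : ℕ} [Fact ℓ.Prime]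
    (hℓk : (ℓ : k) ≠ 0) (F : ℤ[X]) (M : ℕ) :
    ∃ c : ℤ, (((F + C (c * (ℓ : ℤ) ^ M)).coeff 0 : ℤ) : k) ≠ 0 := by
  set q := ringChar k with hq
  haveI : CharP k q := ringChar.charP k
  have hqprime : q.Prime := CharP.char_is_prime k q
  have hqℓ : q ≠ ℓ := by
    rintro h
    apply hℓk
    rw [← h]
    exact CharP.cast_eq_zero k q
  obtain ⟨c, hc⟩ := TateModule.shift_coeff_zero_not_dvd (p := ℓ) hqprime hqℓ F M
  refine ⟨c, fun h0 => hc ?_⟩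
  exact (CharP.intCast_eq_zero_iff k q _).mp h0

/-- **`picardCurve_exists_lambdaAdicRep` from a degree function with étale kernel counts.**  As
`picardCurve_exists_lambdaAdicRep_of_degreeFunction`, but clause (i) — the `ℓ`-power torsion of `ker F(φ)` is
finite of order `ℓ^{v_ℓ(δ F)}` — is required only for monic `F` with `F(0) ≠ 0` in `k` (so that `F(φ)` is an
étale isogeny of the Jacobian and `deg = #ker`, Milne 1986 §19, proof of Thm. 19.1); the general case follows by
`TateModule.forall_ker_of_shift` (shifts `F + c ℓ^M`, `exists_shift_coeff_zero_cast_ne_zero`).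
[cite: MumfordAV1970, §19 Thm. 2, Thm. 4, §21] [cite: Milne1986AbelianVarieties, §12 Prop. 12.9, §19 Thm. 19.1 (proof)]
[cite: Upton2009, Thm. 2.1] -/
theorem picardCurve_exists_lambdaAdicRep_of_degreeFunction_etale
    (hδ : ∀ (k : Type) [Field k] [Fintype k] (Ω : Type) [Field Ω] [Algebra k Ω] [IsAlgClosed Ω]
      [Algebra.IsAlgebraic k Ω] (p : ℕ) [Fact p.Prime] (ℓ : ℕ) [Fact ℓ.Prime] (f : k[X]),
      (p : k) ≠ 0 → (ℓ : k) ≠ 0 → f.Separable → ¬ p ∣ f.natDegree →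
      ∀ [Fact (Irreducible (superellipticPoly k Ω p f))] (φ : Ω ≃ₐ[k] Ω), (∀ x : Ω, φ x = x ^ Fintype.card k) →
        ∃ g : ℕ, (∀ n, Nat.card ((SuperellipticPic k Ω p f)[(ℓ ^ n : ℕ)]) = ℓ ^ (2 * g * n)) ∧
        ∃ (δ : ℤ[X] → ℤ) (P : ℤ[X]), (∀ F G : ℤ[X], δ (F * G) = δ F * δ G) ∧ P.Monic ∧
          (∀ m : ℤ, P.eval m = δ (X - C m)) ∧
          (∀ e : ℕ, ∃ H : MvPolynomial (Fin e) ℚ, ∀ c : Fin e → ℤ,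
            (δ (X ^ e + ∑ i : Fin e, C (c i) * X ^ (i : ℕ)) : ℚ) = MvPolynomial.eval (fun i => (c i : ℚ)) H) ∧
          (∀ F : ℤ[X], F.Monic → ((F.coeff 0 : ℤ) : k) ≠ 0 → δ F ≠ 0 →
            {a : SuperellipticPic k Ω p f | (∃ n : ℕ, ℓ ^ n • a = 0) ∧
                (aeval (DistribMulAction.toAddMonoidEnd (Ω ≃ₐ[k] Ω) (SuperellipticPic k Ω p f) φ) F :
                  AddMonoid.End (SuperellipticPic k Ω p f)) a = 0}.Finite ∧
              Nat.card {a : SuperellipticPic k Ω p f | (∃ n : ℕ, ℓ ^ n • a = 0) ∧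
                (aeval (DistribMulAction.toAddMonoidEnd (Ω ≃ₐ[k] Ω) (SuperellipticPic k Ω p f) φ) F :
                  AddMonoid.End (SuperellipticPic k Ω p f)) a = 0} = ℓ ^ padicValInt ℓ (δ F)) ∧
          (∀ r : ℕ, 0 < r → δ (X ^ r - 1) =
            Nat.card {c : SuperellipticPic k Ω p f //
              SuperellipticPic.degree k Ω p f c = 0 ∧ (φ ^ r) • c = c})) :
    picardCurve_exists_lambdaAdicRep := by
  refine picardCurve_exists_lambdaAdicRep_of_degdet fun k _ _ Ω _ _ _ _ p _ ℓ _ f hpk hℓk hsep hndvd _ φ hφ => ?_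
  obtain ⟨g, hcard, δ, P, hmul, hP, hPδ, hpoly, hker, hfix⟩ := hδ k Ω p ℓ f hpk hℓk hsep hndvd φ hφ
  have hcard' : ∀ n, Nat.card ((SuperellipticPic k Ω p f)[(ℓ ^ n : ℕ)]) = ℓ ^ ((2 * g) * n) := hcard
  haveI := TateModule.free_of_card_torsionBy_rank hcard'
  haveI := TateModule.finite_of_card_torsionBy_rank hcard'
  refine ⟨RationalTateModule.finite_of_card_torsionBy_rank hcard', fun r hr => ?_⟩
  rw [RationalTateModule.det_one_sub_pow_eq_of_degreeFunction_of_shift hcard' φ hmul hP hPδ hpoly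
    (S := fun F : ℤ[X] => ((F.coeff 0 : ℤ) : k) ≠ 0)
    (fun F _ M => exists_shift_coeff_zero_cast_ne_zero k hℓk F M) hker hr, hfix r hr]
  push_cast
  rw [show 2 * g * (r + 1) = 2 * (g * (r + 1)) by ring, pow_mul, neg_one_sq, one_pow, one_mul]

end Literature.NumberTheory.GaloisRepresentations
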